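import Summits.QuantumFields.BalabanUV.Beta.GAN24.FibreSymbols
import Literature.MathematicalPhysics.QuantumFieldTheory.Balaban1983to89.B4Strip
import Literature.MathematicalPhysics.QuantumFieldTheory.King1986.EffectiveLaplacianRate
import Literature.Barriers.CriticalPhenomena.RigorousRGSmallParameterFRDEstimates
import Literature.Probability.LatticeModels.BesselIDebyeAsymptotics

/-!
# `BalabanUV.Beta.GAN24.SymbolTaylor` — binder row G-an2-4 / (CONV-C), road P1-fibre, leaf P1-L07 (node N15 `symbol_taylor`,
# step B1 of `SKELETON-P1.md`): Taylor / two-sided bounds for the finite-difference symbols `∂̂`, `|∂̂|² = lapSym` at REAL momenta,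
# their `N`-scaled (fine-momentum `q/N`) forms, and the Lipschitz bound for the transverse projector in the symbol

NOT IN PRINT; OUR PROOF ATTEMPT.  HONEST FRAMING (cell contract, verbatim): «discharging `BetaPertH` makes Bałaban's UV stability
UNCONDITIONAL — a real constructive-QFT result; it is NOT the continuum limit and NOT the Clay problem.»  HONEST DEPENDENCY (verbatim):
«continuum YM on T⁴ ⇐ BetaPertH ∧ nine spine estimates (0/9 proved); BetaPertH ⇐ (D1) ∧ (D4) ∧ CAP+tail; G-an2-4 gates asym, D1 and
NE2/3/4.»  [folklore] real-analysis inequalities (Taylor with remainder for `sin`/`cos`, Jordan, Cauchy–Schwarz); no cited fact, no wall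
binder, no numerical constant beyond the exact rationals `1/12`, `1/24`, `1/2`, `1/6`, `4/π²`.  NOT summit progress; a leaf of road P1 toward the
binder K-slot `GAN24.CombesThomas.ConvCK 3 Lc` only.

## What is proved (generic dimension `D`; `N > 0` real — instantiate `N = Lc^(j+1)`)
§1 scalar: `4 sin²(x/2) = 2 − 2 cos x`; (`4 sin²(x/2) ≤ x²` and `cos x ≤ 1 − x²/2 + x⁴/24` are REUSED by name from the tree); `x² − x⁴/12 ≤ 4 sin²(x/2)` and hence `|4 sin²(x/2) − x²| ≤ x⁴/12` for ALL real
   `x` (no Brillouin-zone hypothesis — needed at the alias momenta `q = p + 2πm`); Jordan `(4/π²) x² ≤ 4 sin²(x/2)` for `|x| ≤ π`;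
   the phase-removed first-order symbol `|2 sin(x/2) − x| ≤ |x|³/24`; the raw first-order symbol `‖e^{ix} − 1 − ix‖ ≤ x²/2`.
§2 `N`-scaled (fine momentum `q/N`): `|N²·4 sin²(q/(2N)) − q²| ≤ q⁴/(12N²)`, `N²·4 sin²(q/(2N)) ≤ q²`, `(4/π²)q² ≤ N²·4 sin²(q/(2N))` for
   `|q| ≤ πN`, `|2N sin(q/(2N)) − q| ≤ |q|³/(24N²)`, `‖N(e^{iq/N} − 1) − iq‖ ≤ q²/(2N)`.
§3 dictionary to `FibreSymbols` at real momenta `k = ofRealVec kr`: `dhat = e^{ik_κ/2}·(2i sin(k_κ/2))`, `dflat = e^{−ik_κ/2}·(−2i sin(k_κ/2))`,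
   `dhat_κ dflat_l = e^{i(k_κ−k_l)/2}·(2 sin(k_κ/2))(2 sin(k_l/2))` (the off-diagonal FIRST-ORDER content is a pure PHASE), `lapSym = Σ_κ 4 sin²(k_κ/2)`
   (real, `≥ 0`, `= momSq` of the sine vector), and `N²·lapSym(q/N) = King's latticeSymbol N⁻¹ 0 q`; whence the vector bounds
   `(4/π²)|q|² ≤ N² lapSym(q/N) ≤ |q|²` on `|q_κ| ≤ πN` and `|N² lapSym(q/N) − |q|²| ≤ Σ_κ q_κ⁴/(12N²) ≤ |q|⁴/(12N²)` (all `q`).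
§4 (companion module `GAN24/SymbolProjector.lean`, same leaf): the transverse-projector Lipschitz bound `|P(u)_{κl} − P(v)_{κl}| ≤ 4|u − v|/|v|`
   and its lattice instance `|P(2N sin(q/(2N))) − P(q)| ≤ |q|²/(6N²)` entrywise, plus `dhat_κ dflat_l / lapSym = e^{i(k_κ−k_l)/2} · P(s)_{κl}`.
These are the `O(|q|²/N²) = O(Lc^{−2(j+1)})` symbol inputs of Part B (rate `θ = Lc⁻²`) and of the endpoint analysis A4′(v); the
inverse-symbol rate `|(N² lapSym(q/N))⁻¹ − |q|⁻²| ≤ (π²/48)/N²` on the Brillouin zone is then King's `latticeSymbol_inv_sub_ref_le` BY NAME via §3.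
-/

open Complex Finset
open scoped BigOperators Real

namespace Summit.QuantumFields.BalabanUV.Beta.GAN24.SymbolTaylor

open Literature.MathematicalPhysics.QuantumFieldTheory.Balaban1983to89.B4Strip (ofRealVec)
open Literature.MathematicalPhysics.QuantumFieldTheory.King1986 (fdSymbol latticeSymbol momSq momSq_nonneg
  latticeSymbol_le latticeSymbol_ge_jordan sum_pow_four_le_momSq_sq)
open FibreSymbols (dhat dflat lapSym)
-- landed [folklore] scalar facts reused BY NAME (gate dedup rule): `4 sin²(x/2) ≤ x²` and `cos x ≤ 1 − x²/2 + x⁴/24`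
open Literature.Barriers.CriticalPhenomena.LongRangePhi4.FRD (four_mul_sin_sq_half_le_sq)
open Literature.Probability.LatticeModels (cos_le_one_sub_sq_half_add_fourth)

/-! ## §1 Scalar trigonometric Taylor bounds -/

/-- [folklore] Half-angle identity `4 sin²(x/2) = 2 − 2 cos x`. -/
theorem four_sin_sq_half_eq (x : ℝ) : 4 * Real.sin (x / 2) ^ 2 = 2 - 2 * Real.cos x := by
  rw [Real.sin_sq_eq_half_sub]
  have : Real.cos (2 * (x / 2)) = Real.cos x := by congr 1; ring
  rw [this]; ring

/-- [folklore] The global quartic lower bound `x² − x⁴/12 ≤ 4 sin²(x/2)` (no restriction on `x`). -/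
theorem sq_sub_pow_four_le_four_sin_sq_half (x : ℝ) : x ^ 2 - x ^ 4 / 12 ≤ 4 * Real.sin (x / 2) ^ 2 := by
  rw [four_sin_sq_half_eq]
  have := cos_le_one_sub_sq_half_add_fourth x
  linarith

/-- [folklore] **Symbol Taylor bound** `|4 sin²(x/2) − x²| ≤ x⁴/12` for every real `x`. -/
theorem abs_four_sin_sq_half_sub_sq_le (x : ℝ) : |4 * Real.sin (x / 2) ^ 2 - x ^ 2| ≤ x ^ 4 / 12 := by
  rw [abs_le]
  have h1 := four_mul_sin_sq_half_le_sq x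
  have h2 := sq_sub_pow_four_le_four_sin_sq_half x
  have h4 : 0 ≤ x ^ 4 := by positivity
  constructor <;> linarith

/-- [folklore] Jordan's inequality in symbol form: `(4/π²) x² ≤ 4 sin²(x/2)` on the Brillouin zone `|x| ≤ π`. -/
theorem jordan_four_sin_sq_half {x : ℝ} (hx : |x| ≤ π) : 4 / π ^ 2 * x ^ 2 ≤ 4 * Real.sin (x / 2) ^ 2 := by
  rw [four_sin_sq_half_eq]
  have h := Real.cos_le_one_sub_mul_cos_sq hx
  have : 4 / π ^ 2 * x ^ 2 = 2 * (2 / π ^ 2 * x ^ 2) := by ring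
  linarith

/-- [folklore] Phase-removed first-order symbol: `|2 sin(x/2) − x| ≤ |x|³/24` (from `|y − sin y| ≤ |y|³/6`). -/
theorem abs_two_sin_half_sub_le (x : ℝ) : |2 * Real.sin (x / 2) - x| ≤ |x| ^ 3 / 24 := by
  have h := Real.abs_sub_sin_le (x / 2)
  have e : |2 * Real.sin (x / 2) - x| = 2 * |x / 2 - Real.sin (x / 2)| := by
    rw [show 2 * Real.sin (x / 2) - x = (-2) * (x / 2 - Real.sin (x / 2)) by ring, abs_mul]
    norm_num
  have e3 : |x / 2| ^ 3 / 6 = |x| ^ 3 / 48 := by rw [abs_div, abs_two]; ring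
  rw [e]; rw [e3] at h; linarith

/-- [folklore] Raw first-order symbol with its phase: `‖e^{ix} − 1 − ix‖ ≤ x²/2` for every real `x` (the function
`y⁴/4 − ‖e^{iy} − 1 − iy‖² = y⁴/4 − y² − 2 + 2 cos y + 2 y sin y` is even, vanishes at `0`, and has derivative `y (y² − 2(1 − cos y)) ≥ 0` on `y ≥ 0`). -/
theorem norm_cexp_I_mul_sub_one_sub_le (x : ℝ) : ‖cexp (I * x) - 1 - I * x‖ ≤ x ^ 2 / 2 := by
  -- the squared norm in closed form
  have hsq : ‖cexp (I * x) - 1 - I * x‖ ^ 2 = 2 - 2 * Real.cos x - 2 * x * Real.sin x + x ^ 2 := by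
    have hz : cexp (I * x) - 1 - I * x = ((Real.cos x - 1 : ℝ) : ℂ) + ((Real.sin x - x : ℝ) : ℂ) * I := by
      rw [mul_comm I (x : ℂ), Complex.exp_mul_I, ← Complex.ofReal_cos, ← Complex.ofReal_sin]
      push_cast; ring
    rw [hz, Complex.sq_norm, Complex.normSq_add_mul_I]
    linear_combination Real.sin_sq_add_cos_sq x
  -- monotonicity of `g y = y⁴/4 − (2 − 2cos y − 2y sin y + y²)` on `y ≥ 0`
  have key : ∀ y : ℝ, 0 ≤ y → 2 - 2 * Real.cos y - 2 * y * Real.sin y + y ^ 2 ≤ y ^ 4 / 4 := by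
    intro y hy
    let g (u : ℝ) : ℝ := u ^ 4 / 4 - (2 - 2 * Real.cos u - 2 * u * Real.sin u + u ^ 2)
    have hderiv (u : ℝ) : deriv g u = u * (u ^ 2 - (2 - 2 * Real.cos u)) := by
      simp (disch := fun_prop) [g]
      ring
    have hmono : MonotoneOn g (Set.Ici 0) := by
      apply monotoneOn_of_deriv_nonneg (convex_Ici 0) (by fun_prop) (by fun_prop)
      intro u hu
      rw [interior_Ici] at hu
      rw [hderiv]
      have hc : 2 - 2 * Real.cos u ≤ u ^ 2 := by
        rw [← four_sin_sq_half_eq]; exact four_mul_sin_sq_half_le_sq u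
      exact mul_nonneg (le_of_lt hu) (by linarith)
    have h0 : g 0 ≤ g y := hmono (by simp) hy hy
    simp only [g, Real.cos_zero, Real.sin_zero] at h0
    linarith
  have hx2 : ‖cexp (I * x) - 1 - I * x‖ ^ 2 ≤ (x ^ 2 / 2) ^ 2 := by
    rw [hsq]
    rcases le_total 0 x with hx | hx
    · have := key x hx; nlinarith
    · have := key (-x) (by linarith)
      simp only [Real.cos_neg, Real.sin_neg] at this
      nlinarith
  exact (pow_le_pow_iff_left₀ (norm_nonneg _) (by positivity) (by norm_num)).1 hx2

/-! ## §2 `N`-scaled symbols at fine momentum `q/N` -/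

/-- [folklore] `N`-scaled symbol Taylor bound: `|N²·4 sin²(q/(2N)) − q²| ≤ q⁴/(12N²)` for every real `q` and `N ≠ 0`
(coordinatewise form of `|N² L((p+2πm)/N) − |p+2πm|²| ≤ |p+2πm|⁴/(12N²)`; NO Brillouin-zone hypothesis). -/
theorem abs_sq_mul_four_sin_sq_sub_sq_le {N : ℝ} (hN : N ≠ 0) (q : ℝ) :
    |N ^ 2 * (4 * Real.sin (q / (2 * N)) ^ 2) - q ^ 2| ≤ q ^ 4 / (12 * N ^ 2) := by
  have h := abs_four_sin_sq_half_sub_sq_le (q / N)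
  have e : q / N / 2 = q / (2 * N) := by ring
  rw [e] at h
  have hN2 : 0 < N ^ 2 := by positivity
  have e2 : N ^ 2 * (4 * Real.sin (q / (2 * N)) ^ 2) - q ^ 2 = N ^ 2 * (4 * Real.sin (q / (2 * N)) ^ 2 - (q / N) ^ 2) := by
    field_simp
  rw [e2, abs_mul, abs_of_pos hN2]
  calc N ^ 2 * |4 * Real.sin (q / (2 * N)) ^ 2 - (q / N) ^ 2| ≤ N ^ 2 * ((q / N) ^ 4 / 12) :=
        mul_le_mul_of_nonneg_left h hN2.le
    _ = q ^ 4 / (12 * N ^ 2) := by field_simp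

/-- [folklore] Upper bound `N²·4 sin²(q/(2N)) ≤ q²` (all `q`, `N ≠ 0`). -/
theorem sq_mul_four_sin_sq_le_sq {N : ℝ} (hN : N ≠ 0) (q : ℝ) : N ^ 2 * (4 * Real.sin (q / (2 * N)) ^ 2) ≤ q ^ 2 := by
  have h := four_mul_sin_sq_half_le_sq (q / N)
  have e : q / N / 2 = q / (2 * N) := by ring
  rw [e] at h
  have hN2 : 0 < N ^ 2 := by positivity
  calc N ^ 2 * (4 * Real.sin (q / (2 * N)) ^ 2) ≤ N ^ 2 * (q / N) ^ 2 := mul_le_mul_of_nonneg_left h hN2.le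
    _ = q ^ 2 := by field_simp

/-- [folklore] Jordan lower bound `(4/π²) q² ≤ N²·4 sin²(q/(2N))` on the scaled Brillouin zone `|q| ≤ πN` (`N > 0`). -/
theorem jordan_sq_mul_four_sin_sq {N : ℝ} (hN : 0 < N) {q : ℝ} (hq : |q| ≤ π * N) :
    4 / π ^ 2 * q ^ 2 ≤ N ^ 2 * (4 * Real.sin (q / (2 * N)) ^ 2) := by
  have hqN : |q / N| ≤ π := by
    rw [abs_div, abs_of_pos hN, div_le_iff₀ hN]; exact hq
  have h := jordan_four_sin_sq_half hqN
  have e : q / N / 2 = q / (2 * N) := by ring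
  rw [e] at h
  have hN2 : 0 < N ^ 2 := by positivity
  calc 4 / π ^ 2 * q ^ 2 = N ^ 2 * (4 / π ^ 2 * (q / N) ^ 2) := by field_simp
    _ ≤ N ^ 2 * (4 * Real.sin (q / (2 * N)) ^ 2) := mul_le_mul_of_nonneg_left h hN2.le

/-- [folklore] Phase-removed first-order symbol, scaled: `|2N sin(q/(2N)) − q| ≤ |q|³/(24N²)` (`N > 0`, all `q`). -/
theorem abs_two_mul_sin_sub_le {N : ℝ} (hN : 0 < N) (q : ℝ) :
    |2 * N * Real.sin (q / (2 * N)) - q| ≤ |q| ^ 3 / (24 * N ^ 2) := by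
  have h := abs_two_sin_half_sub_le (q / N)
  have e : q / N / 2 = q / (2 * N) := by ring
  rw [e] at h
  have e2 : 2 * N * Real.sin (q / (2 * N)) - q = N * (2 * Real.sin (q / (2 * N)) - q / N) := by
    field_simp
  rw [e2, abs_mul, abs_of_pos hN]
  calc N * |2 * Real.sin (q / (2 * N)) - q / N| ≤ N * (|q / N| ^ 3 / 24) := mul_le_mul_of_nonneg_left h hN.le
    _ = |q| ^ 3 / (24 * N ^ 2) := by rw [abs_div, abs_of_pos hN]; field_simp

/-- [folklore] Raw first-order symbol, scaled: `‖N·(e^{iq/N} − 1) − iq‖ ≤ q²/(2N)` (`N > 0`, all `q`) —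
"`N·∂̂(q/N) = iq·(1 + O(|q|/N))`" of SKELETON-P1 B1. -/
theorem norm_mul_cexp_sub_one_sub_le {N : ℝ} (hN : 0 < N) (q : ℝ) :
    ‖(N : ℂ) * (cexp (I * (q / N : ℝ)) - 1) - I * q‖ ≤ q ^ 2 / (2 * N) := by
  have h := norm_cexp_I_mul_sub_one_sub_le (q / N)
  have hNc : (N : ℂ) ≠ 0 := by exact_mod_cast hN.ne'
  have e : (N : ℂ) * (cexp (I * (q / N : ℝ)) - 1) - I * q = (N : ℂ) * (cexp (I * (q / N : ℝ)) - 1 - I * (q / N : ℝ)) := by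
    push_cast
    field_simp
  rw [e, norm_mul, Complex.norm_real, Real.norm_of_nonneg hN.le]
  calc N * ‖cexp (I * (q / N : ℝ)) - 1 - I * (q / N : ℝ)‖ ≤ N * ((q / N) ^ 2 / 2) := mul_le_mul_of_nonneg_left h hN.le
    _ = q ^ 2 / (2 * N) := by field_simp

/-! ## §3 Dictionary: the `FibreSymbols` symbols at real momenta -/

variable {D : ℕ}

/-- [folklore] `ofRealVec k κ = (k κ : ℂ)`. -/
theorem ofRealVec_apply (k : Fin D → ℝ) (κ : Fin D) : ofRealVec k κ = (k κ : ℂ) := rfl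

/-- [folklore] Phase factorisation of the forward symbol at real momentum: `e^{ix} − 1 = e^{ix/2} · (2i sin(x/2))`. -/
theorem cexp_I_mul_sub_one_eq (x : ℝ) :
    cexp (I * x) - 1 = cexp (I * (x / 2 : ℝ)) * (2 * I * (Real.sin (x / 2) : ℝ)) := by
  set w := cexp (I * (x / 2 : ℝ)) with hw
  set v := cexp (-(I * (x / 2 : ℝ))) with hv
  have hwv : w * v = 1 := by rw [hw, hv, ← Complex.exp_add, add_neg_cancel, Complex.exp_zero]
  have h2 : cexp (I * x) = w * w := by rw [hw, ← Complex.exp_add]; congr 1; push_cast; ring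
  have e1 : cexp (-((x / 2 : ℝ) : ℂ) * I) = v := by rw [hv]; congr 1; ring
  have e2 : cexp (((x / 2 : ℝ) : ℂ) * I) = w := by rw [hw]; congr 1; ring
  have hsin : ((Real.sin (x / 2) : ℝ) : ℂ) = (v - w) * I / 2 := by
    rw [Complex.ofReal_sin, Complex.sin, e1, e2]
  rw [h2, hsin]
  linear_combination (w ^ 2 - w * v) * Complex.I_sq + hwv

/-- [folklore] Phase factorisation of the reflected symbol: `e^{−ix} − 1 = e^{−ix/2} · (−2i sin(x/2))`. -/
theorem cexp_neg_I_mul_sub_one_eq (x : ℝ) :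
    cexp (-(I * x)) - 1 = cexp (-(I * (x / 2 : ℝ))) * (-(2 * I * (Real.sin (x / 2) : ℝ))) := by
  set w := cexp (I * (x / 2 : ℝ)) with hw
  set v := cexp (-(I * (x / 2 : ℝ))) with hv
  have hwv : w * v = 1 := by rw [hw, hv, ← Complex.exp_add, add_neg_cancel, Complex.exp_zero]
  have h2 : cexp (-(I * x)) = v * v := by rw [hv, ← Complex.exp_add]; congr 1; push_cast; ring
  have e1 : cexp (-((x / 2 : ℝ) : ℂ) * I) = v := by rw [hv]; congr 1; ring
  have e2 : cexp (((x / 2 : ℝ) : ℂ) * I) = w := by rw [hw]; congr 1; ring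
  have hsin : ((Real.sin (x / 2) : ℝ) : ℂ) = (v - w) * I / 2 := by
    rw [Complex.ofReal_sin, Complex.sin, e1, e2]
  rw [h2, hsin]
  linear_combination (v ^ 2 - v * w) * Complex.I_sq + hwv

/-- [folklore] `dhat (ofRealVec k) κ = e^{ik_κ/2} · 2i sin(k_κ/2)`. -/
theorem dhat_ofRealVec (k : Fin D → ℝ) (κ : Fin D) :
    dhat (ofRealVec k) κ = cexp (I * (k κ / 2 : ℝ)) * (2 * I * (Real.sin (k κ / 2) : ℝ)) := by
  unfold FibreSymbols.dhat; rw [ofRealVec_apply, cexp_I_mul_sub_one_eq]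

/-- [folklore] `dflat (ofRealVec k) κ = e^{−ik_κ/2} · (−2i sin(k_κ/2))`. -/
theorem dflat_ofRealVec (k : Fin D → ℝ) (κ : Fin D) :
    dflat (ofRealVec k) κ = cexp (-(I * (k κ / 2 : ℝ))) * (-(2 * I * (Real.sin (k κ / 2) : ℝ))) := by
  unfold FibreSymbols.dflat; rw [ofRealVec_apply, cexp_neg_I_mul_sub_one_eq]

/-- [folklore] **The first-order content is a phase**: `dhat_κ · dflat_l = e^{i(k_κ − k_l)/2} · (2 sin(k_κ/2))·(2 sin(k_l/2))` at real `k`. -/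
theorem dhat_mul_dflat_ofRealVec (k : Fin D → ℝ) (κ l : Fin D) :
    dhat (ofRealVec k) κ * dflat (ofRealVec k) l
      = cexp (I * ((k κ - k l) / 2 : ℝ)) * ((2 * Real.sin (k κ / 2)) * (2 * Real.sin (k l / 2)) : ℝ) := by
  rw [dhat_ofRealVec, dflat_ofRealVec]
  have hph : cexp (I * ((k κ - k l) / 2 : ℝ)) = cexp (I * (k κ / 2 : ℝ)) * cexp (-(I * (k l / 2 : ℝ))) := by
    rw [← Complex.exp_add]; congr 1; push_cast; ring
  rw [hph]; push_cast
  ring_nf; rw [Complex.I_sq]; ring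

/-- [folklore] Diagonal case: `dhat_κ · dflat_κ = 4 sin²(k_κ/2)` (real, nonnegative) at real `k`. -/
theorem dhat_mul_dflat_self_ofRealVec (k : Fin D → ℝ) (κ : Fin D) :
    dhat (ofRealVec k) κ * dflat (ofRealVec k) κ = ((4 * Real.sin (k κ / 2) ^ 2 : ℝ) : ℂ) := by
  rw [dhat_mul_dflat_ofRealVec]
  have : ((k κ - k κ) / 2 : ℝ) = 0 := by simp
  rw [this]; push_cast; simp; ring

/-- [folklore] `‖dhat (ofRealVec k) κ‖ = 2|sin(k_κ/2)| ≤ |k_κ|`. -/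
theorem norm_dhat_ofRealVec (k : Fin D → ℝ) (κ : Fin D) : ‖dhat (ofRealVec k) κ‖ = 2 * |Real.sin (k κ / 2)| := by
  unfold FibreSymbols.dhat
  rw [ofRealVec_apply, Complex.norm_exp_I_mul_ofReal_sub_one, Real.norm_eq_abs, abs_mul, abs_two]

/-- [folklore] `‖dhat (ofRealVec k) κ‖ ≤ |k_κ|`. -/
theorem norm_dhat_ofRealVec_le (k : Fin D → ℝ) (κ : Fin D) : ‖dhat (ofRealVec k) κ‖ ≤ |k κ| := by
  unfold FibreSymbols.dhat
  rw [ofRealVec_apply]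
  simpa [Real.norm_eq_abs] using (Real.norm_exp_I_mul_ofReal_sub_one_le (x := k κ))

/-- [folklore] **Laplacian symbol at real momentum**: `lapSym (ofRealVec k) = Σ_κ 4 sin²(k_κ/2)` (a real number, cast to `ℂ`). -/
theorem lapSym_ofRealVec (k : Fin D → ℝ) :
    lapSym (ofRealVec k) = ((∑ κ, 4 * Real.sin (k κ / 2) ^ 2 : ℝ) : ℂ) := by
  unfold FibreSymbols.lapSym
  push_cast
  refine Finset.sum_congr rfl fun κ _ => ?_
  rw [dhat_mul_dflat_self_ofRealVec]; push_cast; ring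

/-- [folklore] `lapSym (ofRealVec k)` has zero imaginary part. -/
theorem lapSym_ofRealVec_im (k : Fin D → ℝ) : (lapSym (ofRealVec k)).im = 0 := by
  rw [lapSym_ofRealVec, Complex.ofReal_im]

/-- [folklore] `Re lapSym (ofRealVec k) = Σ_κ 4 sin²(k_κ/2) ≥ 0`. -/
theorem lapSym_ofRealVec_re (k : Fin D → ℝ) : (lapSym (ofRealVec k)).re = ∑ κ, 4 * Real.sin (k κ / 2) ^ 2 := by
  rw [lapSym_ofRealVec, Complex.ofReal_re]

/-- [folklore] `0 ≤ Re lapSym (ofRealVec k)`. -/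
theorem lapSym_ofRealVec_re_nonneg (k : Fin D → ℝ) : 0 ≤ (lapSym (ofRealVec k)).re := by
  rw [lapSym_ofRealVec_re]; exact Finset.sum_nonneg fun κ _ => by positivity

/-- [folklore] `lapSym (ofRealVec k)` is the squared length `momSq` of the SINE VECTOR `s_κ = 2 sin(k_κ/2)`. -/
theorem lapSym_ofRealVec_eq_momSq (k : Fin D → ℝ) :
    lapSym (ofRealVec k) = ((momSq (fun κ => 2 * Real.sin (k κ / 2)) : ℝ) : ℂ) := by
  rw [lapSym_ofRealVec]; unfold momSq; congr 1
  exact Finset.sum_congr rfl fun κ _ => by ring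

/-- [folklore] **Scaled dictionary**: `N² · lapSym(q/N) = Σ_κ N²·4 sin²(q_κ/(2N))` at fine momentum `q/N` (`N ≠ 0`). -/
theorem sq_mul_lapSym_div (N : ℝ) (q : Fin D → ℝ) :
    (N : ℂ) ^ 2 * lapSym (ofRealVec fun κ => q κ / N) = ((∑ κ, N ^ 2 * (4 * Real.sin (q κ / (2 * N)) ^ 2) : ℝ) : ℂ) := by
  rw [lapSym_ofRealVec]
  have : (∑ κ, N ^ 2 * (4 * Real.sin (q κ / (2 * N)) ^ 2)) = N ^ 2 * ∑ κ, 4 * Real.sin (q κ / N / 2) ^ 2 := by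
    rw [Finset.mul_sum]
    refine Finset.sum_congr rfl fun κ _ => ?_
    rw [show q κ / N / 2 = q κ / (2 * N) by ring]
  rw [this, Complex.ofReal_mul, Complex.ofReal_pow]

/-- [folklore] **King dictionary**: `Σ_κ N²·4 sin²(q_κ/(2N)) = latticeSymbol N⁻¹ 0 q` (King 1986 (4.4) with spacing `η = 1/N`, mass `0`),
so that `King1986.latticeSymbol_inv_sub_ref_le` etc. apply BY NAME to `N² lapSym(q/N)`. -/
theorem sum_sq_mul_four_sin_sq_eq_latticeSymbol {N : ℝ} (hN : N ≠ 0) (q : Fin D → ℝ) :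
    ∑ κ, N ^ 2 * (4 * Real.sin (q κ / (2 * N)) ^ 2) = latticeSymbol N⁻¹ 0 q := by
  unfold latticeSymbol fdSymbol
  rw [add_zero]
  refine Finset.sum_congr rfl fun κ _ => ?_
  have e : N⁻¹ * q κ / 2 = q κ / (2 * N) := by field_simp
  rw [e]; field_simp

/-- [folklore] Vector two-sided bound on the scaled Brillouin zone `|q_κ| ≤ πN` (`N > 0`):
`(4/π²)|q|² ≤ Σ_κ N²·4 sin²(q_κ/(2N)) ≤ |q|²` (`|q|² = momSq q`). -/
theorem two_sided_sq_mul_lapSym {N : ℝ} (hN : 0 < N) {q : Fin D → ℝ} (hq : ∀ κ, |q κ| ≤ π * N) :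
    4 / π ^ 2 * momSq q ≤ ∑ κ, N ^ 2 * (4 * Real.sin (q κ / (2 * N)) ^ 2)
      ∧ ∑ κ, N ^ 2 * (4 * Real.sin (q κ / (2 * N)) ^ 2) ≤ momSq q := by
  unfold momSq
  constructor
  · rw [Finset.mul_sum]
    exact Finset.sum_le_sum fun κ _ => jordan_sq_mul_four_sin_sq hN (hq κ)
  · exact Finset.sum_le_sum fun κ _ => sq_mul_four_sin_sq_le_sq hN.ne' (q κ)

/-- [folklore] The upper half `Σ_κ N²·4 sin²(q_κ/(2N)) ≤ |q|²` needs no zone hypothesis (`N ≠ 0`). -/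
theorem sum_sq_mul_four_sin_sq_le_momSq {N : ℝ} (hN : N ≠ 0) (q : Fin D → ℝ) :
    ∑ κ, N ^ 2 * (4 * Real.sin (q κ / (2 * N)) ^ 2) ≤ momSq q := by
  unfold momSq
  exact Finset.sum_le_sum fun κ _ => sq_mul_four_sin_sq_le_sq hN (q κ)

/-- [folklore] `Σ_κ q_κ⁴ ≤ |q|⁴` (King's `sum_pow_four_le_momSq_sq`, re-exported for convenience). -/
theorem sum_pow_four_le (q : Fin D → ℝ) : ∑ κ, q κ ^ 4 ≤ momSq q ^ 2 := sum_pow_four_le_momSq_sq q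

/-- [folklore] **Vector symbol Taylor bound** (all `q`, `N ≠ 0`):
`|Σ_κ N²·4 sin²(q_κ/(2N)) − |q|²| ≤ Σ_κ q_κ⁴/(12N²) ≤ |q|⁴/(12N²)`. -/
theorem abs_sum_sq_mul_four_sin_sq_sub_momSq_le {N : ℝ} (hN : N ≠ 0) (q : Fin D → ℝ) :
    |∑ κ, N ^ 2 * (4 * Real.sin (q κ / (2 * N)) ^ 2) - momSq q| ≤ (∑ κ, q κ ^ 4) / (12 * N ^ 2)
      ∧ (∑ κ, q κ ^ 4) / (12 * N ^ 2) ≤ momSq q ^ 2 / (12 * N ^ 2) := by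
  constructor
  · unfold momSq
    rw [← Finset.sum_sub_distrib, Finset.sum_div]
    refine (Finset.abs_sum_le_sum_abs _ _).trans (Finset.sum_le_sum fun κ _ => ?_)
    exact abs_sq_mul_four_sin_sq_sub_sq_le hN (q κ)
  · have hN2 : 0 < 12 * N ^ 2 := by positivity
    exact div_le_div_of_nonneg_right (sum_pow_four_le q) hN2.le

/-- [folklore] The same bound for `N² lapSym(q/N)` as a complex number: `‖N² lapSym(q/N) − |q|²‖ ≤ |q|⁴/(12N²)`. -/
theorem norm_sq_mul_lapSym_sub_momSq_le {N : ℝ} (hN : N ≠ 0) (q : Fin D → ℝ) :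
    ‖(N : ℂ) ^ 2 * lapSym (ofRealVec fun κ => q κ / N) - (momSq q : ℝ)‖ ≤ momSq q ^ 2 / (12 * N ^ 2) := by
  rw [sq_mul_lapSym_div, ← Complex.ofReal_sub, Complex.norm_real, Real.norm_eq_abs]
  have h := abs_sum_sq_mul_four_sin_sq_sub_momSq_le hN q
  exact h.1.trans h.2

end Summit.QuantumFields.BalabanUV.Beta.GAN24.SymbolTaylor
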